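import Mathlib
import Summits.Ventures.PercRepro2.RootCutFibres
import Summits.Ventures.PercRepro2.A3PendantFree

/-!
# The fibre masses of `x` across the root pair factor on every pair `(T, W_R)`
(blind cell PercRepro2, night-1 g33; proofs/NIGHT1-G33.md, the root-shield identity; the linear sums
are RootCutSumsLinear.lean, the ratio sums RootCutRatio.lean, the identity RootCutShield.lean)

Setting of RootCutFibres: the roots separate `VR` from `VS`, `x ∈ VS`.  The atoms:
* `rhoR = P_R(Q_R)`, `kap r y = P_R(Q_R, r ↔ y)` (the `R`-side constants of a mark `y ∈ VR`);
* `muS T = P_S(C_S(x) = T, Q_S)`, `muSc r y T = P_S(C_S(x) = T, Q_S, r ↔ y)` (the `S`-side masses of a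
  mark `y ∈ VS ∪ {a₁, a₂}`);
* `rhoT T W_R = P_R(RE T W_R)`, `rhoTc T W_R r y = P_R(RE T W_R, r ↔ y)`.
On the pair `W = T ∪ W_R` every fibre mass factors (`mW_pair`, `Ssig_pair_S`, `Su_pair_S`,
`Ssig_pair_R`, `Su_pair_R`; on a root-free `T ⊆ VS`: `mW_free`, `Ssig_free_S`, `Su_free_S`,
`Ssig_free_R`, `Su_free_R`), the `R`-factors sum over `W_R ⊆ VR` to the constants (`sum_rhoT`,
`sum_rhoTc`), every sum over all fibres is a double sum over the pairs (`sum_pairs_of_fibre`), and every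
`A`-sum is a sum over `T ⊆ VS` (`sum_fibresA_eq`).  Standard axioms.
-/

namespace Summit.Ventures.PercRepro2

open UnionCluster CovForm CutV

namespace CovForm

namespace A3Fibre

namespace RootShield

/-! ## The atoms -/

section Atoms

variable {V : Type*} {E : Type*} [Fintype E] [DecidableEq E] {R : Type*} [CommRing R]

/-- `ρ = P_R(Q_R)`. -/
noncomputable def rhoR (p : E → R) (ends : E → Sym2 V) (a₁ a₂ : V) (ER : Set E)
    [DecidablePred (· ∈ ER)] : R :=
  prob p (sideEvent ER (avoidAll ends a₂ {a₁}))

/-- `κ_r(y) = P_R(Q_R, r ↔ y)`. -/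
noncomputable def kap (p : E → R) (ends : E → Sym2 V) (a₁ a₂ : V) (ER : Set E)
    [DecidablePred (· ∈ ER)] (r y : V) : R :=
  prob p (sideEvent ER (avoidAll ends a₂ {a₁} ∩ connEvent ends r y))

/-- `μ(T) = P_S(C_S(x) = T, Q_S)`. -/
noncomputable def muS (p : E → R) (ends : E → Sym2 V) (a₁ a₂ : V) (ES : Set E)
    [DecidablePred (· ∈ ES)] (x : V) (T : Finset V) : R :=
  prob p (sideEvent ES (clusterEvent ends x (↑T : Set V) ∩ avoidAll ends a₂ {a₁}))

/-- `μ_r^y(T) = P_S(C_S(x) = T, Q_S, r ↔ y)`. -/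
noncomputable def muSc (p : E → R) (ends : E → Sym2 V) (a₁ a₂ : V) (ES : Set E)
    [DecidablePred (· ∈ ES)] (x r y : V) (T : Finset V) : R :=
  prob p (sideEvent ES (clusterEvent ends x (↑T : Set V) ∩
    (avoidAll ends a₂ {a₁} ∩ connEvent ends r y)))

variable [DecidableEq V]

/-- `ρ_T(W_R) = P_R(RE T W_R)`. -/
noncomputable def rhoT (p : E → R) (ends : E → Sym2 V) (a₁ a₂ : V) (ER : Set E)
    [DecidablePred (· ∈ ER)] (T W_R : Finset V) : R :=
  prob p (sideEvent ER (RE ends a₁ a₂ T W_R))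

/-- `ρ_T^{r,y}(W_R) = P_R(RE T W_R, r ↔ y)`. -/
noncomputable def rhoTc (p : E → R) (ends : E → Sym2 V) (a₁ a₂ : V) (ER : Set E)
    [DecidablePred (· ∈ ER)] (T W_R : Finset V) (r y : V) : R :=
  prob p (sideEvent ER (RE ends a₁ a₂ T W_R ∩ connEvent ends r y))

end Atoms

/-! ## The masses on a pair -/

section Masses

variable {V : Type*} {E : Type*} [Fintype V] [DecidableEq V] [Fintype E] [DecidableEq E]
  {R : Type*} [CommRing R] {ends : E → Sym2 V} {a₁ a₂ : V} {VR VS : Finset V} {ER ES : Set E}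
  [DecidablePred (· ∈ ER)] [DecidablePred (· ∈ ES)] {p : E → R}

omit [Fintype V] in
/-- `m_W` on a pair. -/
lemma mW_pair (h : RootCut.IsRootCut ends a₁ a₂ ↑VR ↑VS ER ES) {x : V} (hx : x ∈ VS)
    {T : Finset V} (hT : T ⊆ insert a₁ (insert a₂ VS)) {W_R : Finset V} (hW : W_R ⊆ VR) :
    mW p ends a₁ a₂ x (T ∪ W_R) = muS p ends a₁ a₂ ES x T * rhoT p ends a₁ a₂ ER T W_R :=
  prob_fibre_pair p h hx hT hW

omit [Fintype V] in
/-- `Ssig_y` on a pair, `y` on the `S`-side. -/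
lemma Ssig_pair_S (h : RootCut.IsRootCut ends a₁ a₂ ↑VR ↑VS ER ES) {x : V} (hx : x ∈ VS)
    {T : Finset V} (hT : T ⊆ insert a₁ (insert a₂ VS)) {W_R : Finset V} (hW : W_R ⊆ VR) {y : V}
    (hy : y ∈ (↑VS : Set V) ∪ {a₁, a₂}) :
    Ssig p ends a₁ a₂ x y (T ∪ W_R) =
      (muSc p ends a₁ a₂ ES x a₁ y T - muSc p ends a₁ a₂ ES x a₂ y T) *
        rhoT p ends a₁ a₂ ER T W_R := by
  unfold Ssig muSc rhoT
  rw [prob_fibre_pair_inter_S p h hx hT hW (Or.inr (Or.inl rfl)) hy,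
    prob_fibre_pair_inter_S p h hx hT hW (Or.inr (Or.inr rfl)) hy]
  ring

omit [Fintype V] in
/-- `Su_y` on a pair, `y` on the `S`-side. -/
lemma Su_pair_S (h : RootCut.IsRootCut ends a₁ a₂ ↑VR ↑VS ER ES) {x : V} (hx : x ∈ VS)
    {T : Finset V} (hT : T ⊆ insert a₁ (insert a₂ VS)) {W_R : Finset V} (hW : W_R ⊆ VR) {y : V}
    (hy : y ∈ (↑VS : Set V) ∪ {a₁, a₂}) :
    Su p ends a₁ a₂ x y (T ∪ W_R) =
      (muSc p ends a₁ a₂ ES x a₁ y T + muSc p ends a₁ a₂ ES x a₂ y T) *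
        rhoT p ends a₁ a₂ ER T W_R := by
  unfold Su muSc rhoT
  rw [prob_fibre_pair_inter_S p h hx hT hW (Or.inr (Or.inl rfl)) hy,
    prob_fibre_pair_inter_S p h hx hT hW (Or.inr (Or.inr rfl)) hy]
  ring

omit [Fintype V] in
/-- `Ssig_y` on a pair, `y` on the `R`-side. -/
lemma Ssig_pair_R (h : RootCut.IsRootCut ends a₁ a₂ ↑VR ↑VS ER ES) {x : V} (hx : x ∈ VS)
    {T : Finset V} (hT : T ⊆ insert a₁ (insert a₂ VS)) {W_R : Finset V} (hW : W_R ⊆ VR) {y : V}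
    (hy : y ∈ (↑VR : Set V) ∪ {a₁, a₂}) :
    Ssig p ends a₁ a₂ x y (T ∪ W_R) =
      muS p ends a₁ a₂ ES x T *
        (rhoTc p ends a₁ a₂ ER T W_R a₁ y - rhoTc p ends a₁ a₂ ER T W_R a₂ y) := by
  unfold Ssig muS rhoTc
  rw [prob_fibre_pair_inter_R p h hx hT hW (Or.inr (Or.inl rfl)) hy,
    prob_fibre_pair_inter_R p h hx hT hW (Or.inr (Or.inr rfl)) hy]
  ring

omit [Fintype V] in
/-- `Su_y` on a pair, `y` on the `R`-side. -/
lemma Su_pair_R (h : RootCut.IsRootCut ends a₁ a₂ ↑VR ↑VS ER ES) {x : V} (hx : x ∈ VS)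
    {T : Finset V} (hT : T ⊆ insert a₁ (insert a₂ VS)) {W_R : Finset V} (hW : W_R ⊆ VR) {y : V}
    (hy : y ∈ (↑VR : Set V) ∪ {a₁, a₂}) :
    Su p ends a₁ a₂ x y (T ∪ W_R) =
      muS p ends a₁ a₂ ES x T *
        (rhoTc p ends a₁ a₂ ER T W_R a₁ y + rhoTc p ends a₁ a₂ ER T W_R a₂ y) := by
  unfold Su muS rhoTc
  rw [prob_fibre_pair_inter_R p h hx hT hW (Or.inr (Or.inl rfl)) hy,
    prob_fibre_pair_inter_R p h hx hT hW (Or.inr (Or.inr rfl)) hy]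
  ring

omit [DecidablePred (· ∈ ES)] in
/-- The `R`-factors sum to `ρ`. -/
lemma sum_rhoT (h : RootCut.IsRootCut ends a₁ a₂ ↑VR ↑VS ER ES) (T : Finset V) :
    ∑ W_R ∈ VR.powerset, rhoT p ends a₁ a₂ ER T W_R = rhoR p ends a₁ a₂ ER := by
  have key := sum_prob_RE_inter p h T Set.univ
  simp only [Set.inter_univ] at key
  unfold rhoT rhoR
  exact key

omit [DecidablePred (· ∈ ES)] in
/-- The `R`-factors with a connection sum to `κ`. -/
lemma sum_rhoTc (h : RootCut.IsRootCut ends a₁ a₂ ↑VR ↑VS ER ES) (T : Finset V) (r y : V) :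
    ∑ W_R ∈ VR.powerset, rhoTc p ends a₁ a₂ ER T W_R r y = kap p ends a₁ a₂ ER r y := by
  unfold rhoTc kap
  exact sum_prob_RE_inter p h T (connEvent ends r y)

omit [Fintype V] [Fintype E] [DecidableEq E] [DecidablePred (· ∈ ER)] [DecidablePred (· ∈ ES)] in
/-- On a root-free `T`, `RE T ∅ = Q`. -/
lemma RE_free_empty {T : Finset V} (h1 : a₁ ∉ T) (h2 : a₂ ∉ T) :
    RE ends a₁ a₂ T ∅ = avoidAll ends a₂ {a₁} := by
  unfold RE
  rw [if_neg h1, if_neg h2, if_pos rfl]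

omit [Fintype V] [Fintype E] [DecidableEq E] [DecidablePred (· ∈ ER)] [DecidablePred (· ∈ ES)] in
/-- A subset of `VS` is root-free and lies in `VS ∪ {a₁, a₂}`. -/
lemma roots_notMem_of_subset_VS (h : RootCut.IsRootCut ends a₁ a₂ ↑VR ↑VS ER ES) {T : Finset V}
    (hT : T ⊆ VS) : (a₁ ∉ T ∧ a₂ ∉ T) ∧ T ⊆ insert a₁ (insert a₂ VS) :=
  ⟨⟨fun hc => h.a₁_notS (Finset.mem_coe.2 (hT hc)), fun hc => h.a₂_notS (Finset.mem_coe.2 (hT hc))⟩,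
    fun _ hv => Finset.mem_insert_of_mem (Finset.mem_insert_of_mem (hT hv))⟩

omit [Fintype V] [DecidablePred (· ∈ ES)] in
/-- On a root-free `T`, `ρ_T(∅) = ρ`. -/
lemma rhoT_free_empty {T : Finset V} (h1 : a₁ ∉ T) (h2 : a₂ ∉ T) :
    rhoT p ends a₁ a₂ ER T ∅ = rhoR p ends a₁ a₂ ER := by
  unfold rhoT rhoR
  rw [RE_free_empty h1 h2]

omit [Fintype V] [DecidablePred (· ∈ ES)] in
/-- On a root-free `T`, `ρ_T^{r,y}(∅) = κ_r(y)`. -/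
lemma rhoTc_free_empty {T : Finset V} (h1 : a₁ ∉ T) (h2 : a₂ ∉ T) (r y : V) :
    rhoTc p ends a₁ a₂ ER T ∅ r y = kap p ends a₁ a₂ ER r y := by
  unfold rhoTc kap
  rw [RE_free_empty h1 h2]

omit [Fintype V] [DecidableEq V] [DecidablePred (· ∈ ER)] [DecidablePred (· ∈ ES)] in
/-- The masses of an empty fibre vanish. -/
lemma masses_eq_zero_of_fibre_eq_empty {x : V} {W : Finset V} (hW : fibre ends a₁ a₂ x W = ∅)
    (y : V) :
    mW p ends a₁ a₂ x W = 0 ∧ Ssig p ends a₁ a₂ x y W = 0 ∧ Su p ends a₁ a₂ x y W = 0 := by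
  unfold mW Ssig Su
  rw [hW]
  simp

omit [Fintype V] in
/-- `m_W` on a root-free `T ⊆ VS`. -/
lemma mW_free (h : RootCut.IsRootCut ends a₁ a₂ ↑VR ↑VS ER ES) {x : V} (hx : x ∈ VS)
    {T : Finset V} (hT : T ⊆ VS) :
    mW p ends a₁ a₂ x T = muS p ends a₁ a₂ ES x T * rhoR p ends a₁ a₂ ER := by
  obtain ⟨⟨h1, h2⟩, hT'⟩ := roots_notMem_of_subset_VS h hT
  have key := mW_pair (p := p) h hx hT' (Finset.empty_subset VR)
  rwa [Finset.union_empty, rhoT_free_empty h1 h2] at key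

omit [Fintype V] in
/-- `Ssig_y` on a root-free `T ⊆ VS`, `y` on the `S`-side. -/
lemma Ssig_free_S (h : RootCut.IsRootCut ends a₁ a₂ ↑VR ↑VS ER ES) {x : V} (hx : x ∈ VS)
    {T : Finset V} (hT : T ⊆ VS) {y : V} (hy : y ∈ (↑VS : Set V) ∪ {a₁, a₂}) :
    Ssig p ends a₁ a₂ x y T =
      (muSc p ends a₁ a₂ ES x a₁ y T - muSc p ends a₁ a₂ ES x a₂ y T) * rhoR p ends a₁ a₂ ER := by
  obtain ⟨⟨h1, h2⟩, hT'⟩ := roots_notMem_of_subset_VS h hT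
  have key := Ssig_pair_S (p := p) h hx hT' (Finset.empty_subset VR) hy
  rwa [Finset.union_empty, rhoT_free_empty h1 h2] at key

omit [Fintype V] in
/-- `Su_y` on a root-free `T ⊆ VS`, `y` on the `S`-side. -/
lemma Su_free_S (h : RootCut.IsRootCut ends a₁ a₂ ↑VR ↑VS ER ES) {x : V} (hx : x ∈ VS)
    {T : Finset V} (hT : T ⊆ VS) {y : V} (hy : y ∈ (↑VS : Set V) ∪ {a₁, a₂}) :
    Su p ends a₁ a₂ x y T =
      (muSc p ends a₁ a₂ ES x a₁ y T + muSc p ends a₁ a₂ ES x a₂ y T) * rhoR p ends a₁ a₂ ER := by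
  obtain ⟨⟨h1, h2⟩, hT'⟩ := roots_notMem_of_subset_VS h hT
  have key := Su_pair_S (p := p) h hx hT' (Finset.empty_subset VR) hy
  rwa [Finset.union_empty, rhoT_free_empty h1 h2] at key

omit [Fintype V] in
/-- `Ssig_y` on a root-free `T ⊆ VS`, `y` on the `R`-side. -/
lemma Ssig_free_R (h : RootCut.IsRootCut ends a₁ a₂ ↑VR ↑VS ER ES) {x : V} (hx : x ∈ VS)
    {T : Finset V} (hT : T ⊆ VS) {y : V} (hy : y ∈ (↑VR : Set V) ∪ {a₁, a₂}) :
    Ssig p ends a₁ a₂ x y T =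
      muS p ends a₁ a₂ ES x T * (kap p ends a₁ a₂ ER a₁ y - kap p ends a₁ a₂ ER a₂ y) := by
  obtain ⟨⟨h1, h2⟩, hT'⟩ := roots_notMem_of_subset_VS h hT
  have key := Ssig_pair_R (p := p) h hx hT' (Finset.empty_subset VR) hy
  rwa [Finset.union_empty, rhoTc_free_empty h1 h2, rhoTc_free_empty h1 h2] at key

omit [Fintype V] in
/-- `Su_y` on a root-free `T ⊆ VS`, `y` on the `R`-side. -/
lemma Su_free_R (h : RootCut.IsRootCut ends a₁ a₂ ↑VR ↑VS ER ES) {x : V} (hx : x ∈ VS)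
    {T : Finset V} (hT : T ⊆ VS) {y : V} (hy : y ∈ (↑VR : Set V) ∪ {a₁, a₂}) :
    Su p ends a₁ a₂ x y T =
      muS p ends a₁ a₂ ES x T * (kap p ends a₁ a₂ ER a₁ y + kap p ends a₁ a₂ ER a₂ y) := by
  obtain ⟨⟨h1, h2⟩, hT'⟩ := roots_notMem_of_subset_VS h hT
  have key := Su_pair_R (p := p) h hx hT' (Finset.empty_subset VR) hy
  rwa [Finset.union_empty, rhoTc_free_empty h1 h2, rhoTc_free_empty h1 h2] at key

omit [Fintype E] [DecidableEq E] [DecidablePred (· ∈ ER)] [DecidablePred (· ∈ ES)] in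
/-- **Every sum over the fibres of `x` is a double sum over the pairs.** -/
lemma sum_pairs_of_fibre (h : RootCut.IsRootCut ends a₁ a₂ ↑VR ↑VS ER ES) {x : V} (hx : x ∈ VS)
    (f : Finset V → R) (hf : ∀ W, fibre ends a₁ a₂ x W = ∅ → f W = 0) :
    ∑ W, f W = ∑ T ∈ (insert a₁ (insert a₂ VS)).powerset, ∑ W_R ∈ VR.powerset, f (T ∪ W_R) :=
  sum_eq_sum_pairs _ VR (disjoint_insert_roots_VR h) f fun W hW =>
    hf W (fibre_eq_empty_of_not_subset h hx hW)

omit [Fintype E] [DecidableEq E] in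
/-- **Every `A`-sum over the fibres of `x` is a sum over `T ⊆ VS`.** -/
lemma sum_fibresA_eq (h : RootCut.IsRootCut ends a₁ a₂ ↑VR ↑VS ER ES) {x : V} (hx : x ∈ VS)
    (f : Finset V → R) (hf : ∀ W, fibre ends a₁ a₂ x W = ∅ → f W = 0) :
    ∑ W ∈ fibresA a₁ a₂, f W = ∑ T ∈ VS.powerset, f T := by
  symm
  apply Finset.sum_subset
  · intro T hT
    rw [Finset.mem_powerset] at hT
    rw [fibresA, Finset.mem_filter]
    exact ⟨Finset.mem_univ _, (roots_notMem_of_subset_VS h hT).1⟩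
  · intro W hW hWS
    rw [fibresA, Finset.mem_filter] at hW
    rw [Finset.mem_powerset] at hWS
    apply hf
    by_cases hsub : W ⊆ insert a₁ (insert a₂ VS) ∪ VR
    · obtain ⟨v, hv, hvS⟩ := Finset.not_subset.1 hWS
      rcases Finset.mem_union.1 (hsub hv) with hvS' | hvR
      · exfalso
        rcases Finset.mem_insert.1 hvS' with rfl | hvS'
        · exact hW.2.1 hv
        rcases Finset.mem_insert.1 hvS' with rfl | hvS'
        · exact hW.2.2 hv
        · exact hvS hvS'
      · exact fibre_eq_empty_of_free_inter_VR h hx hW.2.1 hW.2.2 hv hvR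
    · exact fibre_eq_empty_of_not_subset h hx hsub

end Masses

end RootShield

end A3Fibre

end CovForm

end Summit.Ventures.PercRepro2
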